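import Mathlib
import Summits.ResolutionOfSingularities.ResolutionOfSingularities.Theorems.RadicialJungCleanModelsCleanProp44OfTauOnePieces
import Summits.ResolutionOfSingularities.ResolutionOfSingularities.Theorems.RadicialJungCleanModelsCleanReachPhaseOne
import Summits.ResolutionOfSingularities.ResolutionOfSingularities.Theorems.FrobeniusLadderFInjectiveMacaulayficationProp44TidyPieces
import HarnessLib

/-!
# Route `RadicialJung`, crux `CleanModels` (stmt-ResolutionOfSingularities-15917), line `Sketch` rev 35, stub 6 `stub_cleanProp44` (X44c):
# THE CLEAN ASSEMBLY, THIRD CUT — X44c from CLEAN PHASE II of reach-tidy + the two `τ = 1` slices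

With clean Phase I in the kernel (✓ `exists_cleanSeq_regular_transverse`, `…CleanReachPhaseOne.lean`) the hypothesis `hreach` of
✓ `cleanProp44_of_tauOnePieces` reduces to CLEAN PHASE II ([CoP1] Prop. 4.4, proof, step 3: from a stage with NO bad point — the curves of `Σ`
regular and pairwise transverse — blow up intersecting curves of `Σ`, keeping cleanness, until the curves of `Σ` are pairwise DISJOINT; the
binders of ✓ `CP2008Prop44.reach_tidy_of_noBad` plus the clean data, conclusion with a CLEAN-permissible sequence), the pieces of the tidy stage being
read off by the tree's ✓ `CP2008Prop44.exists_pieces_of_tidy`.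

* `cleanReach_of_cleanPhaseTwo` — clean Phase II ⟹ `hreach` (Phase I ✓, Phase II hypothesis, pieces ✓, composition ✓).
* `cleanProp44_of_tauOneResidual` — **`hphaseTwo → htauOne → hcurveTauOne →` the statement of `stub_cleanProp44` VERBATIM.**

KERNEL CENSUS OF STUB 6 (X44c) after this file: exactly three named statements remain, all in the `τ = 1` regime of [CoP1] (crossings of `Σ`-curves,
`τ = 1` isolated points, curves through a `τ = 1` point) — the places where L7b's insertions can create new curves of `Σ` (births, memo 4e §2.4–2.6,
(B′) settled by hand for perfect residue fields, (B5′) open).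

Honest framing: OURS; the three hypotheses are NOT proved here; nothing here proves X44c, any case of `CleanModels`, or resolution in characteristic `p`.
-/

noncomputable section

set_option linter.dupNamespace false -- mandated namespace of this single-conjunct summit

open CategoryTheory CategoryTheory.Limits AlgebraicGeometry TopologicalSpace IsLocalRing
open Literature.AlgebraicGeometry.Resolution Literature.AlgebraicGeometry.Motives
open Scheme.IdealSheafData
open Summit.ResolutionOfSingularities.ResolutionOfSingularities.Theorems.CP2008Prop44

namespace Summit.ResolutionOfSingularities.ResolutionOfSingularities.Theorems.RadicialJung.CleanModels

set_option maxHeartbeats 800000 in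
-- long binder lists
/-- **Clean reach-tidy from clean Phase II.**  `hphaseTwo` = the binders of ✓ `CP2008Prop44.reach_tidy_of_noBad` plus the clean data (`char K(X) = p`, the
line of `G` clean-regular everywhere), conclusion with a CLEAN-permissible sequence; then the hypothesis `hreach` of ✓ `cleanProp44_of_cleanPieces` holds
(clean Phase I ✓ `exists_cleanSeq_regular_transverse`, then `hphaseTwo` on the reached stage — invariants over the forgetful map —, pieces by
✓ `exists_pieces_of_tidy`, composition ✓ `IsCleanPermissibleSeq.comp`). [cite: CossartPiltant2008, Prop. 4.4 (proof, pp. 9–10, steps 1–3)] -/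
theorem cleanReach_of_cleanPhaseTwo
    (hphaseTwo : ∀ (p : ℕ), p.Prime → ∀ {X : Scheme.{0}} [IsIntegral X] [IsNoetherian X], CharP X.functionField p →
      ∀ (hX : Scheme.IsRegular X), Scheme.IsQuasiExcellent X → topologicalKrullDim X ≤ 3 →
      ∀ (G : X.functionField), (∀ x : X, CleanRegAt p (algebraMap (X.presheaf.stalk x) X.functionField) G) →
      ∀ (J : X.IdealSheafData) {μ : ℕ}, 1 ≤ μ → (∀ z, idealOrder J z ≤ μ) → (∀ z ∈ J.support, 1 < Order.coheight z) →
      (∀ x : X, ¬ ∃ C ∈ {C : Closeds X | ∃ ζ ∈ maxPoints {z : X | (μ : ℕ∞) ≤ idealOrder J z},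
          ¬ IsClosed ({ζ} : Set X) ∧ C = ⟨closure {ζ}, isClosed_closure⟩},
        x ∈ (vanishingIdeal C).subschemeι '' (Scheme.regularLocus (vanishingIdeal C).subscheme)ᶜ ∨
        (x ∈ (C : Set X) ∧ ∃ C' ∈ {C : Closeds X | ∃ ζ ∈ maxPoints {z : X | (μ : ℕ∞) ≤ idealOrder J z},
            ¬ IsClosed ({ζ} : Set X) ∧ C = ⟨closure {ζ}, isClosed_closure⟩}, C' ≠ C ∧ x ∈ (C' : Set X) ∧
          stalkIdeal (vanishingIdeal C) x ⊔ stalkIdeal (vanishingIdeal C') x ≠ maximalIdeal (X.presheaf.stalk x))) →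
      ∃ (X₁ : Scheme.{0}) (Φ : X₁ ⟶ X) (_ : IsIntegral X₁) (_ : IsDominant Φ) (J₁ : X₁.IdealSheafData)
        (_ : IsCleanPermissibleSeq p Φ J μ J₁ G),
        (∀ ζ : X₁, (μ : ℕ∞) ≤ idealOrder J₁ ζ → Order.coheight ζ = 2 → ¬ IsClosed ({ζ} : Set X₁) →
            Scheme.IsRegular (vanishingIdeal (⟨closure {ζ}, isClosed_closure⟩ : Closeds X₁)).subscheme) ∧
        (∀ ζ₁ ζ₂ : X₁, (μ : ℕ∞) ≤ idealOrder J₁ ζ₁ → Order.coheight ζ₁ = 2 → ¬ IsClosed ({ζ₁} : Set X₁) →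
            (μ : ℕ∞) ≤ idealOrder J₁ ζ₂ → Order.coheight ζ₂ = 2 → ¬ IsClosed ({ζ₂} : Set X₁) → ζ₁ ≠ ζ₂ →
            Disjoint (closure ({ζ₁} : Set X₁)) (closure {ζ₂}))) :
    ∀ (p : ℕ), p.Prime → ∀ {X : Scheme.{0}} [IsIntegral X] [IsNoetherian X], CharP X.functionField p →
      ∀ (hX : Scheme.IsRegular X), Scheme.IsQuasiExcellent X → topologicalKrullDim X ≤ 3 →
      ∀ (G : X.functionField), (∀ x : X, CleanRegAt p (algebraMap (X.presheaf.stalk x) X.functionField) G) →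
      ∀ (J : X.IdealSheafData) {μ : ℕ}, 1 ≤ μ → (∀ z, idealOrder J z ≤ μ) → (∀ z ∈ J.support, 1 < Order.coheight z) →
      ∃ (X₁ : Scheme.{0}) (Φ : X₁ ⟶ X) (_ : IsIntegral X₁) (_ : IsDominant Φ) (J₁ : X₁.IdealSheafData)
        (_ : IsCleanPermissibleSeq p Φ J μ J₁ G) (n : ℕ) (Z : Fin n → Set X₁),
        (∀ i, IsClosed (Z i)) ∧ (∀ i j, i ≠ j → Disjoint (Z i) (Z j)) ∧
        (∀ z : X₁, (μ : ℕ∞) ≤ idealOrder J₁ z → ∃ i, z ∈ Z i) ∧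
        ∀ i, (∃ x : X₁, Z i = {x} ∧ idealOrder J₁ x = μ ∧ (maximalIdeal (X₁.presheaf.stalk x)).spanFinrank = 3 ∧
                ∀ hr : IsRegularLocalRing (X₁.presheaf.stalk x), 2 ≤ @stalkTau X₁ J₁ x hr μ) ∨
             (∃ x : X₁, Z i = {x} ∧ idealOrder J₁ x = μ ∧ (maximalIdeal (X₁.presheaf.stalk x)).spanFinrank = 3 ∧
                ∀ hr : IsRegularLocalRing (X₁.presheaf.stalk x), @stalkTau X₁ J₁ x hr μ = 1) ∨
             (∃ x : X₁, Z i = {x} ∧ idealOrder J₁ x = μ ∧ Order.coheight x = 2) ∨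
             (∃ Y : Closeds X₁, Z i = (Y : Set X₁) ∧ Scheme.IsRegular (vanishingIdeal Y).subscheme ∧
                IsIrreducible (Y : Set X₁) ∧ (∀ y ∈ (Y : Set X₁), idealOrder J₁ y = μ) ∧
                ∀ y ∈ (Y : Set X₁), ∀ hr : IsRegularLocalRing (X₁.presheaf.stalk y),
                  ∃ c : Fin 2 → X₁.presheaf.stalk y, @IsRsopPart _ _ _ 2 c ∧
                    Ideal.span (Set.range c) = stalkIdeal (vanishingIdeal Y) y) := by
  intro p hp X _ _ hchar hX hqe hX3 G hG J μ hμ hle hcodim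
  -- Phase I (clean, ✓)
  obtain ⟨X₁, Φ₁, hX₁i, hΦ₁, J₁, hseq₁, hRT₁⟩ := exists_cleanSeq_regular_transverse hp hX hqe hX3 G hG J hμ hle hcodim
  haveI := hX₁i
  haveI := hΦ₁
  have hseqW₁ := isPermissibleBlowupSeq_of_isPermissibleSeq hseq₁.isPermissibleSeq
  obtain ⟨-, hnoeth₁, hX₁, hqe₁, hle₁, hcodim₁⟩ := IsPermissibleBlowupSeq.prop44Invariants hX hqe hμ hle hcodim hseqW₁
  haveI := hnoeth₁
  have hX3₁ : topologicalKrullDim X₁ ≤ 3 := hseqW₁.topologicalKrullDim_le inferInstance hX3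
  haveI hchar₁ : CharP X₁.functionField p := charP_of_injective_ringHom (RatFn.functionFieldMap Φ₁).injective p
  have hG₁ : ∀ x : X₁, CleanRegAt p (algebraMap (X₁.presheaf.stalk x) X₁.functionField) (RatFn.functionFieldMap Φ₁ G) :=
    hseq₁.cleanRegAt hp hchar hG
  -- Phase II (HYPOTHESIS)
  obtain ⟨X₂, Φ₂, hX₂i, hΦ₂, J₂, hseq₂, htidy₁, htidy₂⟩ :=
    hphaseTwo p hp hchar₁ hX₁ hqe₁ hX3₁ (RatFn.functionFieldMap Φ₁ G) hG₁ J₁ hμ hle₁ hcodim₁ hRT₁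
  haveI := hX₂i
  haveI := hΦ₂
  have hseqW₂ := isPermissibleBlowupSeq_of_isPermissibleSeq hseq₂.isPermissibleSeq
  obtain ⟨-, hnoeth₂, hX₂, hqe₂, hle₂, hcodim₂⟩ := IsPermissibleBlowupSeq.prop44Invariants hX₁ hqe₁ hμ hle₁ hcodim₁ hseqW₂
  haveI := hnoeth₂
  have hX3₂ : topologicalKrullDim X₂ ≤ 3 := hseqW₂.topologicalKrullDim_le inferInstance hX3₁
  -- the pieces of the tidy stage (✓)
  obtain ⟨n, Z, h1, h2, h3, h4⟩ := exists_pieces_of_tidy hX₂ hqe₂ hX3₂ J₂ hμ hle₂ hcodim₂ htidy₁ htidy₂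
  exact ⟨X₂, Φ₂ ≫ Φ₁, inferInstance, inferInstance, J₂, hseq₁.comp hseq₂ rfl, n, Z, h1, h2, h3, h4⟩

set_option maxHeartbeats 800000 in
-- long binder lists
/-- **THE CLEAN ASSEMBLY, THIRD CUT: X44c (`stub_cleanProp44`, verbatim) from CLEAN PHASE II of reach-tidy, the clean `τ = 1` isolated-point slice and
the clean regular-curve slice through a `τ = 1` point.**  See the module docstring. [cite: CossartPiltant2008, Prop. 4.4] [cite: Piltant2013, Prop. 5.1 (proof, Step 2)] -/
theorem cleanProp44_of_tauOneResidual
    (hphaseTwo : ∀ (p : ℕ), p.Prime → ∀ {X : Scheme.{0}} [IsIntegral X] [IsNoetherian X], CharP X.functionField p →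
      ∀ (hX : Scheme.IsRegular X), Scheme.IsQuasiExcellent X → topologicalKrullDim X ≤ 3 →
      ∀ (G : X.functionField), (∀ x : X, CleanRegAt p (algebraMap (X.presheaf.stalk x) X.functionField) G) →
      ∀ (J : X.IdealSheafData) {μ : ℕ}, 1 ≤ μ → (∀ z, idealOrder J z ≤ μ) → (∀ z ∈ J.support, 1 < Order.coheight z) →
      (∀ x : X, ¬ ∃ C ∈ {C : Closeds X | ∃ ζ ∈ maxPoints {z : X | (μ : ℕ∞) ≤ idealOrder J z},
          ¬ IsClosed ({ζ} : Set X) ∧ C = ⟨closure {ζ}, isClosed_closure⟩},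
        x ∈ (vanishingIdeal C).subschemeι '' (Scheme.regularLocus (vanishingIdeal C).subscheme)ᶜ ∨
        (x ∈ (C : Set X) ∧ ∃ C' ∈ {C : Closeds X | ∃ ζ ∈ maxPoints {z : X | (μ : ℕ∞) ≤ idealOrder J z},
            ¬ IsClosed ({ζ} : Set X) ∧ C = ⟨closure {ζ}, isClosed_closure⟩}, C' ≠ C ∧ x ∈ (C' : Set X) ∧
          stalkIdeal (vanishingIdeal C) x ⊔ stalkIdeal (vanishingIdeal C') x ≠ maximalIdeal (X.presheaf.stalk x))) →
      ∃ (X₁ : Scheme.{0}) (Φ : X₁ ⟶ X) (_ : IsIntegral X₁) (_ : IsDominant Φ) (J₁ : X₁.IdealSheafData)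
        (_ : IsCleanPermissibleSeq p Φ J μ J₁ G),
        (∀ ζ : X₁, (μ : ℕ∞) ≤ idealOrder J₁ ζ → Order.coheight ζ = 2 → ¬ IsClosed ({ζ} : Set X₁) →
            Scheme.IsRegular (vanishingIdeal (⟨closure {ζ}, isClosed_closure⟩ : Closeds X₁)).subscheme) ∧
        (∀ ζ₁ ζ₂ : X₁, (μ : ℕ∞) ≤ idealOrder J₁ ζ₁ → Order.coheight ζ₁ = 2 → ¬ IsClosed ({ζ₁} : Set X₁) →
            (μ : ℕ∞) ≤ idealOrder J₁ ζ₂ → Order.coheight ζ₂ = 2 → ¬ IsClosed ({ζ₂} : Set X₁) → ζ₁ ≠ ζ₂ →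
            Disjoint (closure ({ζ₁} : Set X₁)) (closure {ζ₂})))
    (htauOne : ∀ (p : ℕ), p.Prime → ∀ {X : Scheme.{0}} [IsIntegral X] [IsNoetherian X], CharP X.functionField p →
      ∀ (hX : Scheme.IsRegular X), Scheme.IsQuasiExcellent X → topologicalKrullDim X ≤ 3 →
      ∀ (G : X.functionField), (∀ x : X, CleanRegAt p (algebraMap (X.presheaf.stalk x) X.functionField) G) →
      ∀ (J : X.IdealSheafData) {m : ℕ}, 1 ≤ m → (∀ z, idealOrder J z ≤ m) → (∀ z ∈ J.support, 1 < Order.coheight z) →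
      ∀ (V : X.Opens) (x : X), x ∈ V → ∀ (hcl : IsClosed ({x} : Set X)),
      (∀ z : X, (m : ℕ∞) ≤ idealOrder J z → z = x ∨ z ∉ (V : Set X)) → idealOrder J x = m →
      (maximalIdeal (X.presheaf.stalk x)).spanFinrank = 3 → (haveI := hX x; stalkTau J x m = 1) → IsGRing (X.presheaf.stalk x) →
      ∀ [IsIntegral ((V : X.Opens) : Scheme.{0})] [IsDominant V.ι],
      ∃ (V' : Scheme.{0}) (π : V' ⟶ V) (_ : IsIntegral V') (_ : IsDominant π) (K' : V'.IdealSheafData),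
        IsCleanPermissibleSeq p π (J.comap V.ι) m K' (RatFn.functionFieldMap V.ι G) ∧ ∀ y, idealOrder K' y < m)
    (hcurveTauOne : ∀ (p : ℕ), p.Prime → ∀ {X : Scheme.{0}} [IsIntegral X] [IsNoetherian X], CharP X.functionField p →
      ∀ (hX : Scheme.IsRegular X), Scheme.IsQuasiExcellent X → topologicalKrullDim X ≤ 3 →
      ∀ (G : X.functionField), (∀ x : X, CleanRegAt p (algebraMap (X.presheaf.stalk x) X.functionField) G) →
      ∀ (J : X.IdealSheafData) {m : ℕ}, 1 ≤ m → (∀ z, idealOrder J z ≤ m) → (∀ z ∈ J.support, 1 < Order.coheight z) →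
      ∀ (V : X.Opens) (Y : Closeds X), Scheme.IsRegular (vanishingIdeal Y).subscheme → IsIrreducible (Y : Set X) →
      (Y : Set X) ⊆ (V : Set X) → (∀ z : X, (m : ℕ∞) ≤ idealOrder J z → z ∈ (Y : Set X) ∨ z ∉ (V : Set X)) →
      (∀ y ∈ (Y : Set X), idealOrder J y = m) →
      (∀ y ∈ (Y : Set X), haveI := hX y; ∃ c : Fin 2 → X.presheaf.stalk y, IsRsopPart c ∧
        Ideal.span (Set.range c) = stalkIdeal (vanishingIdeal Y) y) →
      (¬ ∀ y ∈ (Y : Set X), IsClosed ({y} : Set X) → haveI := hX y; 2 ≤ stalkTau J y m) →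
      ∀ [IsIntegral ((V : X.Opens) : Scheme.{0})] [IsDominant V.ι],
      ∃ (V' : Scheme.{0}) (π : V' ⟶ V) (_ : IsIntegral V') (_ : IsDominant π) (K' : V'.IdealSheafData),
        IsCleanPermissibleSeq p π (J.comap V.ι) m K' (RatFn.functionFieldMap V.ι G) ∧ ∀ y, idealOrder K' y < m) :
    ∀ (p : ℕ), p.Prime → ∀ (S : Scheme.{0}) [IsIntegral S] [IsNoetherian S],
      CharP S.functionField p → Scheme.IsRegular S → Scheme.IsExcellent S → topologicalKrullDim S = 3 →
      ∀ G₀ : S.functionField, (∀ s : S, CleanRegAt p (algebraMap (S.presheaf.stalk s) S.functionField) G₀) →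
      ∀ I : S.IdealSheafData, I ≠ ⊥ →
      ∀ (X : Scheme.{0}) (ρ : X ⟶ S) [IsIntegral X] [IsNoetherian X] [IsDominant ρ],
        IsCleanRegularCentreBlowupSeq p ρ I G₀ →
        (∀ x : X, CleanRegAt p (algebraMap (X.presheaf.stalk x) X.functionField) (RatFn.functionFieldMap ρ G₀)) →
        ∀ (J : X.IdealSheafData) (μ : ℕ), 1 ≤ μ →
          (∀ x ∈ J.support, 1 < Order.coheight x) → (∀ x, idealOrder J x ≤ μ) → (∃ x, idealOrder J x = μ) →
          ∃ (X' : Scheme.{0}) (π : X' ⟶ X) (_ : IsIntegral X') (_ : IsDominant π) (J' : X'.IdealSheafData),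
            IsCleanPermissibleSeq p π J μ J' (RatFn.functionFieldMap ρ G₀) ∧ ∀ x, idealOrder J' x < μ :=
  cleanProp44_of_tauOnePieces (cleanReach_of_cleanPhaseTwo hphaseTwo) htauOne hcurveTauOne

end Summit.ResolutionOfSingularities.ResolutionOfSingularities.Theorems.RadicialJung.CleanModels

end
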